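import Mathlib
import Literature.Analysis.FluidPDE.SteadyNSLocalEnergy
import Literature.Analysis.FluidPDE.SteadyLiouvilleTsaiPressure
import HarnessLib

/-!
# Scaled local energy inequality and product test functions for the flux-sign stub

Second tools file for `stub_fluxSign` of
`Summit.AnomalousDissipation.AnomalousDissipation.Theses.DyadicWallCascade.DyadicRealisation`
(line Sketch):

* `fluxSign_energy_ineq` — for a bounded smooth solution `(W, P)` of the clause-form steady
  Navier–Stokes system on `ℝ³` and a non-negative test function `φ ∈ C²_c`, the blow-downs
  `W(λ·), P(λ·)` satisfy `0 ≤ λ⁻¹ A + ∫ (Dφ·W(λ·)) (|W(λ·)|²/2 + P(λ·))` with `A` independent of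
  `λ` (the tree's localised energy identity `IsLerayProfile.integral_mul_frobeniusNormSq_eq`
  applied to the Navier–Stokes rescaling `(λW(λ·), λ²P(λ·))`, `Tsai2021.isLerayProfile_scale`);
* `fluxSign_testfun` — smoothness, compact support and the gradient of the product test function
  `Y ↦ χ(Y₀) χ(Y₁) θ(Y₂)`;
* `fluxSign_density_lipschitz` — the energy-flux density `w₂(|w|²/2 + p)` is Lipschitz on bounded
  sets.

The file ends with the registered tools stub `stub_fluxSignTools2`.
-/

open MeasureTheory Set Filter Topology Function
open Literature.Analysis.FluidPDE
open scoped BigOperators Laplacian RealInnerProductSpace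

set_option linter.dupNamespace false

namespace Summit.AnomalousDissipation.AnomalousDissipation.Theorems

/-- **The clause-form steady system is the profile class `IsLerayProfile 1 0`.** [folklore] -/
theorem fluxSign_isLerayProfile
    {W : EuclideanSpace ℝ (Fin 3) → EuclideanSpace ℝ (Fin 3)} {P : EuclideanSpace ℝ (Fin 3) → ℝ}
    (hW : ContDiff ℝ ((⊤ : ℕ∞) : WithTop ℕ∞) W) (hP : ContDiff ℝ ((⊤ : ℕ∞) : WithTop ℕ∞) P)
    (hdiv : ∀ X, ∑ i : Fin 3, (fderiv ℝ W X (EuclideanSpace.single i (1 : ℝ))) i = 0)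
    (hNS : ∀ X, (fderiv ℝ W X) (W X) + gradient P X =
      ∑ i : Fin 3, fderiv ℝ (fun Y => fderiv ℝ W Y (EuclideanSpace.single i (1 : ℝ))) X
        (EuclideanSpace.single i (1 : ℝ))) :
    IsLerayProfile 1 0 W P := by
  have hW2 : ContDiff ℝ 2 W := contDiff_infty.1 hW 2
  have hlap : ∀ X, (Δ W) X =
      ∑ i : Fin 3, fderiv ℝ (fun Y => fderiv ℝ W Y (EuclideanSpace.single i (1 : ℝ))) X
        (EuclideanSpace.single i (1 : ℝ)) := by
    intro X
    rw [laplacian_eq_sum_fderiv_fderiv (EuclideanSpace.basisFun (Fin 3) ℝ) hW2 X]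
    simp only [EuclideanSpace.basisFun_apply]
  exact
    { contDiff_velocity := hW2
      contDiff_pressure := contDiff_infty.1 hP 1
      profile_eq := fun X => by
        simp only [one_smul, zero_smul, add_zero, convect_apply]
        rw [hlap X, ← hNS X]
        abel
      divFree := fun X => by
        rw [divergence_eq_sum_inner_fderiv (EuclideanSpace.basisFun (Fin 3) ℝ) W X]
        simpa only [EuclideanSpace.basisFun_apply, EuclideanSpace.inner_single_left, map_one,
          one_mul] using hdiv X }

/-- **Scaled localised energy inequality.** For a bounded smooth solution `(W, P)` of the
clause-form steady Navier–Stokes system on `ℝ³` (unit viscosity, no force) and a test function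
`φ ∈ C²_c`, `φ ≥ 0`, there is `A` such that for every `λ > 0`
`0 ≤ λ⁻¹ A + ∫ (Dφ(Y)·W(λY)) (|W(λY)|²/2 + P(λY)) dY`: the localised energy identity for the
rescaled solution `(λW(λ·), λ²P(λ·))`, divided by `λ³`, the dissipation term being non-negative
and `|½∫ Δφ |W(λ·)|²| ≤ A := ½ sup|W|² ∫|Δφ|`. [folklore] -/
theorem fluxSign_energy_ineq
    (W : EuclideanSpace ℝ (Fin 3) → EuclideanSpace ℝ (Fin 3)) (P : EuclideanSpace ℝ (Fin 3) → ℝ)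
    (φ : EuclideanSpace ℝ (Fin 3) → ℝ) (C' : ℝ)
    (hW : ContDiff ℝ ((⊤ : ℕ∞) : WithTop ℕ∞) W) (hP : ContDiff ℝ ((⊤ : ℕ∞) : WithTop ℕ∞) P)
    (hdiv : ∀ X, ∑ i : Fin 3, (fderiv ℝ W X (EuclideanSpace.single i (1 : ℝ))) i = 0)
    (hNS : ∀ X, (fderiv ℝ W X) (W X) + gradient P X =
      ∑ i : Fin 3, fderiv ℝ (fun Y => fderiv ℝ W Y (EuclideanSpace.single i (1 : ℝ))) X
        (EuclideanSpace.single i (1 : ℝ)))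
    (hWb : ∀ X, ‖W X‖ ≤ C') (hφ : ContDiff ℝ 2 φ) (hφc : HasCompactSupport φ)
    (hφ0 : ∀ Y, 0 ≤ φ Y) :
    ∃ A : ℝ, ∀ lam : ℝ, 0 < lam →
      0 ≤ lam⁻¹ * A + ∫ Y, fderiv ℝ φ Y (W (lam • Y)) * (‖W (lam • Y)‖ ^ 2 / 2 + P (lam • Y)) := by
  have hprof : IsLerayProfile 1 0 W P := fluxSign_isLerayProfile hW hP hdiv hNS
  have hWc : Continuous W := hW.continuous
  have hPc : Continuous P := hP.continuous
  have hDφc : Continuous (fderiv ℝ φ) := hφ.continuous_fderiv (by norm_num)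
  have hDφcs : HasCompactSupport (fderiv ℝ φ) := hφc.fderiv (𝕜 := ℝ)
  have hΔφc : Continuous (Δ φ) := continuous_laplacian hφ
  have hΔφcs : HasCompactSupport (Δ φ) := hφc.mono' fun x hx => by
    contrapose! hx; simp [laplacian_eq_zero_of_notMem_tsupport hx]
  set K : ℝ := ∫ Y, |(Δ φ) Y| with hK
  refine ⟨2⁻¹ * (C' ^ 2 * K), fun lam hlam => ?_⟩
  have hsc : Continuous fun Y : EuclideanSpace ℝ (Fin 3) => lam • Y := continuous_const_smul lam
  have hWl : Continuous fun Y : EuclideanSpace ℝ (Fin 3) => W (lam • Y) := hWc.comp hsc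
  have hPl : Continuous fun Y : EuclideanSpace ℝ (Fin 3) => P (lam • Y) := hPc.comp hsc
  -- the identity for the rescaled solution
  have hl := Tsai2021.isLerayProfile_scale hprof hlam
  have hid := hl.integral_mul_frobeniusNormSq_eq hφ hφc
  have hL : 0 ≤ ∫ x, φ x * frobeniusNormSq (fderiv ℝ (fun x => lam • W (lam • x)) x) :=
    integral_nonneg fun x => mul_nonneg (hφ0 x) (frobeniusNormSq_nonneg _)
  rw [hid] at hL
  have e1 : ∫ x, (Δ φ) x * ‖lam • W (lam • x)‖ ^ 2 =
      lam ^ 2 * ∫ x, (Δ φ) x * ‖W (lam • x)‖ ^ 2 := by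
    rw [← integral_const_mul]
    refine integral_congr_ae (Eventually.of_forall fun x => ?_)
    simp only
    rw [norm_smul, Real.norm_of_nonneg hlam.le]; ring
  have e2 : ∫ x, fderiv ℝ φ x (lam • W (lam • x)) * ‖lam • W (lam • x)‖ ^ 2 =
      lam ^ 3 * ∫ x, fderiv ℝ φ x (W (lam • x)) * ‖W (lam • x)‖ ^ 2 := by
    rw [← integral_const_mul]
    refine integral_congr_ae (Eventually.of_forall fun x => ?_)
    simp only
    rw [map_smul, norm_smul, Real.norm_of_nonneg hlam.le, smul_eq_mul]; ring
  have e3 : ∫ x, lam ^ 2 * P (lam • x) * fderiv ℝ φ x (lam • W (lam • x)) =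
      lam ^ 3 * ∫ x, fderiv ℝ φ x (W (lam • x)) * P (lam • x) := by
    rw [← integral_const_mul]
    refine integral_congr_ae (Eventually.of_forall fun x => ?_)
    simp only
    rw [map_smul, smul_eq_mul]; ring
  rw [e1, e2, e3] at hL
  -- integrability
  have hI1 : Integrable fun x => (Δ φ) x * ‖W (lam • x)‖ ^ 2 :=
    (hΔφc.mul ((hWl.norm).pow 2)).integrable_of_hasCompactSupport hΔφcs.mul_right
  have hI1' : Integrable fun x => |(Δ φ) x| * C' ^ 2 :=
    ((continuous_abs.comp hΔφc).mul continuous_const).integrable_of_hasCompactSupport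
      (hΔφcs.abs.mul_right)
  have hsupp : ∀ r : EuclideanSpace ℝ (Fin 3) → ℝ,
      HasCompactSupport fun x => fderiv ℝ φ x (W (lam • x)) * r x := by
    intro r
    refine hDφcs.mono fun x hx => ?_
    rw [mem_support] at hx ⊢
    contrapose! hx
    rw [hx, _root_.zero_apply, zero_mul]
  have hcont : Continuous fun x => fderiv ℝ φ x (W (lam • x)) := hDφc.clm_apply hWl
  have hI2 : Integrable fun x => fderiv ℝ φ x (W (lam • x)) * ‖W (lam • x)‖ ^ 2 :=
    (hcont.mul ((hWl.norm).pow 2)).integrable_of_hasCompactSupport (hsupp _)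
  have hI3 : Integrable fun x => fderiv ℝ φ x (W (lam • x)) * P (lam • x) :=
    (hcont.mul hPl).integrable_of_hasCompactSupport (hsupp _)
  -- the Laplacian term
  have hA : ∫ x, (Δ φ) x * ‖W (lam • x)‖ ^ 2 ≤ C' ^ 2 * K := by
    rw [hK, ← integral_const_mul]
    simp_rw [mul_comm (C' ^ 2)]
    refine integral_mono hI1 hI1' fun x => ?_
    simp only
    calc (Δ φ) x * ‖W (lam • x)‖ ^ 2 ≤ |(Δ φ) x| * ‖W (lam • x)‖ ^ 2 :=
          mul_le_mul_of_nonneg_right (le_abs_self _) (sq_nonneg _)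
      _ ≤ |(Δ φ) x| * C' ^ 2 :=
          mul_le_mul_of_nonneg_left (pow_le_pow_left₀ (norm_nonneg _) (hWb _) 2) (abs_nonneg _)
  -- combining the transport terms
  have hsum : 2⁻¹ * (∫ x, fderiv ℝ φ x (W (lam • x)) * ‖W (lam • x)‖ ^ 2) +
      (∫ x, fderiv ℝ φ x (W (lam • x)) * P (lam • x)) =
      ∫ Y, fderiv ℝ φ Y (W (lam • Y)) * (‖W (lam • Y)‖ ^ 2 / 2 + P (lam • Y)) := by
    rw [← integral_const_mul, ← integral_add (hI2.const_mul _) hI3]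
    refine integral_congr_ae (Eventually.of_forall fun x => ?_)
    simp only
    ring
  rw [← hsum]
  have h3 : 0 < lam ^ 3 := pow_pos hlam 3
  have step1 : 0 ≤ lam ^ 2 * (2⁻¹ * (C' ^ 2 * K)) +
      lam ^ 3 * (2⁻¹ * (∫ x, fderiv ℝ φ x (W (lam • x)) * ‖W (lam • x)‖ ^ 2) +
        ∫ x, fderiv ℝ φ x (W (lam • x)) * P (lam • x)) := by
    have := mul_le_mul_of_nonneg_left hA (sq_nonneg lam)
    linarith
  rw [← mul_nonneg_iff_of_pos_left h3]
  have : lam ^ 3 * (lam⁻¹ * (2⁻¹ * (C' ^ 2 * K)) +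
      (2⁻¹ * (∫ x, fderiv ℝ φ x (W (lam • x)) * ‖W (lam • x)‖ ^ 2) +
        ∫ x, fderiv ℝ φ x (W (lam • x)) * P (lam • x))) =
      lam ^ 2 * (2⁻¹ * (C' ^ 2 * K)) +
      lam ^ 3 * (2⁻¹ * (∫ x, fderiv ℝ φ x (W (lam • x)) * ‖W (lam • x)‖ ^ 2) +
        ∫ x, fderiv ℝ φ x (W (lam • x)) * P (lam • x)) := by
    field_simp
  rw [this]
  exact step1

/-- **Product test functions.** For smooth `χ, θ : ℝ → ℝ` the function
`φ(Y) = χ(Y₀) χ(Y₁) θ(Y₂)` on `ℝ³` is smooth, its gradient is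
`Dφ(Y) w = χ'(Y₀) w₀ χ(Y₁) θ(Y₂) + χ(Y₀) χ'(Y₁) w₁ θ(Y₂) + χ(Y₀) χ(Y₁) θ'(Y₂) w₂`, and it is
compactly supported when `χ` and `θ` are. [folklore] -/
theorem fluxSign_testfun (χ θ : ℝ → ℝ) (hχ : ContDiff ℝ ((⊤ : ℕ∞) : WithTop ℕ∞) χ)
    (hθ : ContDiff ℝ ((⊤ : ℕ∞) : WithTop ℕ∞) θ) :
    ContDiff ℝ ((⊤ : ℕ∞) : WithTop ℕ∞)
        (fun Y : EuclideanSpace ℝ (Fin 3) => χ (Y 0) * χ (Y 1) * θ (Y 2)) ∧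
      (∀ Y w : EuclideanSpace ℝ (Fin 3),
        fderiv ℝ (fun Y : EuclideanSpace ℝ (Fin 3) => χ (Y 0) * χ (Y 1) * θ (Y 2)) Y w =
          deriv χ (Y 0) * w 0 * χ (Y 1) * θ (Y 2) + χ (Y 0) * (deriv χ (Y 1) * w 1) * θ (Y 2) +
            χ (Y 0) * χ (Y 1) * (deriv θ (Y 2) * w 2)) ∧
      (HasCompactSupport χ → HasCompactSupport θ →
        HasCompactSupport (fun Y : EuclideanSpace ℝ (Fin 3) => χ (Y 0) * χ (Y 1) * θ (Y 2))) := by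
  have hp : ∀ i : Fin 3, ContDiff ℝ ((⊤ : ℕ∞) : WithTop ℕ∞)
      (fun Y : EuclideanSpace ℝ (Fin 3) => Y i) := fun i => contDiff_piLp_apply (p := 2)
  refine ⟨((hχ.comp (hp 0)).mul (hχ.comp (hp 1))).mul (hθ.comp (hp 2)), fun Y w => ?_,
    fun hχc hθc => ?_⟩
  · have hχd : ∀ t, HasDerivAt χ (deriv χ t) t := fun t =>
      ((hχ.differentiable (by simp)) t).hasDerivAt
    have hθd : ∀ t, HasDerivAt θ (deriv θ t) t := fun t =>
      ((hθ.differentiable (by simp)) t).hasDerivAt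
    have h0 : HasFDerivAt (fun Y : EuclideanSpace ℝ (Fin 3) => χ (Y 0))
        (deriv χ (Y 0) • PiLp.proj 2 (fun _ : Fin 3 => ℝ) 0) Y :=
      (hχd (Y 0)).comp_hasFDerivAt Y (PiLp.hasFDerivAt_apply (𝕜 := ℝ) 2 Y 0)
    have h1 : HasFDerivAt (fun Y : EuclideanSpace ℝ (Fin 3) => χ (Y 1))
        (deriv χ (Y 1) • PiLp.proj 2 (fun _ : Fin 3 => ℝ) 1) Y :=
      (hχd (Y 1)).comp_hasFDerivAt Y (PiLp.hasFDerivAt_apply (𝕜 := ℝ) 2 Y 1)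
    have h2 : HasFDerivAt (fun Y : EuclideanSpace ℝ (Fin 3) => θ (Y 2))
        (deriv θ (Y 2) • PiLp.proj 2 (fun _ : Fin 3 => ℝ) 2) Y :=
      (hθd (Y 2)).comp_hasFDerivAt Y (PiLp.hasFDerivAt_apply (𝕜 := ℝ) 2 Y 2)
    have hF : HasFDerivAt (fun Y : EuclideanSpace ℝ (Fin 3) => χ (Y 0) * χ (Y 1) * θ (Y 2))
        ((χ (Y 0) * χ (Y 1)) • (deriv θ (Y 2) • PiLp.proj 2 (fun _ : Fin 3 => ℝ) 2) +
          θ (Y 2) • (χ (Y 0) • (deriv χ (Y 1) • PiLp.proj 2 (fun _ : Fin 3 => ℝ) 1) +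
            χ (Y 1) • (deriv χ (Y 0) • PiLp.proj 2 (fun _ : Fin 3 => ℝ) 0))) Y :=
      (h0.mul h1).mul h2
    rw [hF.fderiv]
    simp only [_root_.add_apply, _root_.smul_apply, PiLp.proj_apply, smul_eq_mul]
    ring
  · obtain ⟨r, hr⟩ : ∃ r : ℝ, ∀ t, χ t ≠ 0 → |t| ≤ r := by
      obtain ⟨r, hr⟩ := hχc.isCompact.isBounded.subset_closedBall 0
      refine ⟨r, fun t ht => ?_⟩
      have : t ∈ Metric.closedBall (0 : ℝ) r := hr (subset_tsupport _ (mem_support.2 ht))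
      simpa [Real.dist_eq] using this
    obtain ⟨s, hs⟩ : ∃ s : ℝ, ∀ t, θ t ≠ 0 → |t| ≤ s := by
      obtain ⟨s, hs⟩ := hθc.isCompact.isBounded.subset_closedBall 0
      refine ⟨s, fun t ht => ?_⟩
      have : t ∈ Metric.closedBall (0 : ℝ) s := hs (subset_tsupport _ (mem_support.2 ht))
      simpa [Real.dist_eq] using this
    refine HasCompactSupport.intro (isCompact_closedBall (0 : EuclideanSpace ℝ (Fin 3)) (r + r + s))
      fun Y hY => ?_
    by_contra h
    have h0 : χ (Y 0) ≠ 0 := fun h' => h (by rw [h', zero_mul, zero_mul])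
    have h1 : χ (Y 1) ≠ 0 := fun h' => h (by rw [h', mul_zero, zero_mul])
    have h2 : θ (Y 2) ≠ 0 := fun h' => h (by rw [h', mul_zero])
    refine hY (mem_closedBall_zero_iff.2 ?_)
    have hn : ‖Y‖ ≤ |Y 0| + |Y 1| + |Y 2| := by
      rw [EuclideanSpace.norm_eq Y, Fin.sum_univ_three, Real.sqrt_le_left (by positivity)]
      simp only [Real.norm_eq_abs]
      nlinarith [abs_nonneg (Y 0), abs_nonneg (Y 1), abs_nonneg (Y 2), sq_abs (Y 0), sq_abs (Y 1),
        sq_abs (Y 2)]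
    linarith [hr _ h0, hr _ h1, hs _ h2]

/-- **The energy-flux density is Lipschitz on bounded sets**: for `|w|, |p| ≤ C'` and
`|v|, |q| ≤ C`, `|w₂(|w|²/2 + p) − v₂(|v|²/2 + q)| ≤ L (|w − v| + |p − q|)` with
`L = C'²/2 + |C'| + |C| ((|C'| + |C|)/2 + 1)`. [folklore] -/
theorem fluxSign_density_lipschitz (w v : EuclideanSpace ℝ (Fin 3)) (p q C C' : ℝ)
    (hw : ‖w‖ ≤ C') (hp : |p| ≤ C') (hv : ‖v‖ ≤ C) :
    |w 2 * (‖w‖ ^ 2 / 2 + p) - v 2 * (‖v‖ ^ 2 / 2 + q)| ≤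
      (C' ^ 2 / 2 + |C'| + |C| * ((|C'| + |C|) / 2 + 1)) * (‖w - v‖ + |p - q|) := by
  have h2w : |w 2 - v 2| ≤ ‖w - v‖ := by
    have := PiLp.norm_apply_le (w - v) 2
    simpa using this
  have hv2 : |v 2| ≤ |C| := by
    have := PiLp.norm_apply_le v 2
    rw [Real.norm_eq_abs] at this
    exact this.trans (hv.trans (le_abs_self C))
  have hnn : |‖w‖ - ‖v‖| ≤ ‖w - v‖ := abs_norm_sub_norm_le w v
  have hC' : ‖w‖ ≤ |C'| := hw.trans (le_abs_self _)
  have hCv : ‖v‖ ≤ |C| := hv.trans (le_abs_self _)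
  have hp' : |p| ≤ |C'| := hp.trans (le_abs_self _)
  -- decomposition
  have key : w 2 * (‖w‖ ^ 2 / 2 + p) - v 2 * (‖v‖ ^ 2 / 2 + q) =
      (w 2 - v 2) * (‖w‖ ^ 2 / 2 + p) +
        v 2 * ((‖w‖ - ‖v‖) * (‖w‖ + ‖v‖) / 2 + (p - q)) := by ring
  rw [key]
  have t1 : |(w 2 - v 2) * (‖w‖ ^ 2 / 2 + p)| ≤ ‖w - v‖ * (C' ^ 2 / 2 + |C'|) := by
    rw [abs_mul]
    refine mul_le_mul h2w ?_ (abs_nonneg _) (norm_nonneg _)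
    calc |‖w‖ ^ 2 / 2 + p| ≤ |‖w‖ ^ 2 / 2| + |p| := abs_add_le _ _
      _ ≤ C' ^ 2 / 2 + |C'| := by
          rw [abs_of_nonneg (by positivity)]
          have : ‖w‖ ^ 2 ≤ C' ^ 2 := by
            have := pow_le_pow_left₀ (norm_nonneg _) hC' 2
            rwa [sq_abs] at this
          linarith
  have t2 : |v 2 * ((‖w‖ - ‖v‖) * (‖w‖ + ‖v‖) / 2 + (p - q))| ≤
      |C| * (‖w - v‖ * ((|C'| + |C|) / 2) + |p - q|) := by
    rw [abs_mul]
    refine mul_le_mul hv2 ?_ (abs_nonneg _) (abs_nonneg _)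
    calc |(‖w‖ - ‖v‖) * (‖w‖ + ‖v‖) / 2 + (p - q)|
        ≤ |(‖w‖ - ‖v‖) * (‖w‖ + ‖v‖) / 2| + |p - q| := abs_add_le _ _
      _ ≤ ‖w - v‖ * ((|C'| + |C|) / 2) + |p - q| := by
          gcongr
          rw [abs_div, abs_mul, abs_two, abs_of_nonneg (by positivity : (0 : ℝ) ≤ ‖w‖ + ‖v‖)]
          have : |‖w‖ - ‖v‖| * (‖w‖ + ‖v‖) ≤ ‖w - v‖ * (|C'| + |C|) :=
            mul_le_mul hnn (add_le_add hC' hCv) (by positivity) (norm_nonneg _)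
          linarith
  calc |(w 2 - v 2) * (‖w‖ ^ 2 / 2 + p) + v 2 * ((‖w‖ - ‖v‖) * (‖w‖ + ‖v‖) / 2 + (p - q))|
      ≤ |(w 2 - v 2) * (‖w‖ ^ 2 / 2 + p)| + |v 2 * ((‖w‖ - ‖v‖) * (‖w‖ + ‖v‖) / 2 + (p - q))| :=
        abs_add_le _ _
    _ ≤ ‖w - v‖ * (C' ^ 2 / 2 + |C'|) + |C| * (‖w - v‖ * ((|C'| + |C|) / 2) + |p - q|) :=
        add_le_add t1 t2
    _ ≤ (C' ^ 2 / 2 + |C'| + |C| * ((|C'| + |C|) / 2 + 1)) * (‖w - v‖ + |p - q|) := by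
        have h1 : 0 ≤ ‖w - v‖ := norm_nonneg _
        have h2 : 0 ≤ |p - q| := abs_nonneg _
        have h3 : 0 ≤ |C| := abs_nonneg _
        have h4 : 0 ≤ |C'| := abs_nonneg _
        nlinarith [mul_nonneg h3 h2, mul_nonneg h3 h1, mul_nonneg h4 h2, mul_nonneg (sq_nonneg C') h2,
          mul_nonneg (mul_nonneg h3 h4) h2, mul_nonneg (mul_nonneg h3 h3) h2,
          mul_nonneg (mul_nonneg h3 h4) h1, mul_nonneg (mul_nonneg h3 h3) h1]

/-- Registered tools stub of `stub_fluxSign` (line Sketch of crux `DyadicRealisation`): the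
conjunction of the lemmas of this file. [folklore] -/
theorem stub_fluxSignTools2 :
    (∀ (W : EuclideanSpace ℝ (Fin 3) → EuclideanSpace ℝ (Fin 3)) (P : EuclideanSpace ℝ (Fin 3) → ℝ),
    ContDiff ℝ ((⊤ : ℕ∞) : WithTop ℕ∞) W → ContDiff ℝ ((⊤ : ℕ∞) : WithTop ℕ∞) P → (∀ X :
    EuclideanSpace ℝ (Fin 3), ∑ i : Fin 3, (fderiv ℝ W X (EuclideanSpace.single i (1 : ℝ))) i = 0) →
    (∀ X : EuclideanSpace ℝ (Fin 3), (fderiv ℝ W X) (W X) + gradient P X = ∑ i : Fin 3, fderiv ℝ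
    (fun Y => fderiv ℝ W Y (EuclideanSpace.single i (1 : ℝ))) X (EuclideanSpace.single i (1 : ℝ))) →
    Literature.Analysis.FluidPDE.IsLerayProfile 1 0 W P) ∧ (∀ (W : EuclideanSpace ℝ (Fin 3) →
    EuclideanSpace ℝ (Fin 3)) (P : EuclideanSpace ℝ (Fin 3) → ℝ) (φ : EuclideanSpace ℝ (Fin 3) → ℝ)
    (C' : ℝ), ContDiff ℝ ((⊤ : ℕ∞) : WithTop ℕ∞) W → ContDiff ℝ ((⊤ : ℕ∞) : WithTop ℕ∞) P → (∀ X :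
    EuclideanSpace ℝ (Fin 3), ∑ i : Fin 3, (fderiv ℝ W X (EuclideanSpace.single i (1 : ℝ))) i = 0) →
    (∀ X : EuclideanSpace ℝ (Fin 3), (fderiv ℝ W X) (W X) + gradient P X = ∑ i : Fin 3, fderiv ℝ
    (fun Y => fderiv ℝ W Y (EuclideanSpace.single i (1 : ℝ))) X (EuclideanSpace.single i (1 : ℝ))) →
    (∀ X : EuclideanSpace ℝ (Fin 3), ‖W X‖ ≤ C') → ContDiff ℝ 2 φ → HasCompactSupport φ → (∀ Y :
    EuclideanSpace ℝ (Fin 3), 0 ≤ φ Y) → ∃ A : ℝ, ∀ lam : ℝ, 0 < lam → 0 ≤ lam⁻¹ * A + ∫ Y :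
    EuclideanSpace ℝ (Fin 3), fderiv ℝ φ Y (W (lam • Y)) * (‖W (lam • Y)‖ ^ 2 / 2 + P (lam • Y))) ∧
    (∀ (χ θ : ℝ → ℝ), ContDiff ℝ ((⊤ : ℕ∞) : WithTop ℕ∞) χ → ContDiff ℝ ((⊤ : ℕ∞) : WithTop ℕ∞) θ →
    ContDiff ℝ ((⊤ : ℕ∞) : WithTop ℕ∞) (fun Y : EuclideanSpace ℝ (Fin 3) => χ (Y 0) * χ (Y 1) * θ (Y
    2)) ∧ (∀ Y w : EuclideanSpace ℝ (Fin 3), fderiv ℝ (fun Y : EuclideanSpace ℝ (Fin 3) => χ (Y 0) *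
    χ (Y 1) * θ (Y 2)) Y w = deriv χ (Y 0) * w 0 * χ (Y 1) * θ (Y 2) + χ (Y 0) * (deriv χ (Y 1) * w
    1) * θ (Y 2) + χ (Y 0) * χ (Y 1) * (deriv θ (Y 2) * w 2)) ∧ (HasCompactSupport χ →
    HasCompactSupport θ → HasCompactSupport (fun Y : EuclideanSpace ℝ (Fin 3) => χ (Y 0) * χ (Y 1) *
    θ (Y 2)))) ∧ (∀ (w v : EuclideanSpace ℝ (Fin 3)) (p q C C' : ℝ), ‖w‖ ≤ C' → |p| ≤ C' → ‖v‖ ≤ C →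
    |w 2 * (‖w‖ ^ 2 / 2 + p) - v 2 * (‖v‖ ^ 2 / 2 + q)| ≤ (C' ^ 2 / 2 + |C'| + |C| * ((|C'| + |C|) /
    2 + 1)) * (‖w - v‖ + |p - q|)) :=
  ⟨fun _ _ hW hP hdiv hNS => fluxSign_isLerayProfile hW hP hdiv hNS, fluxSign_energy_ineq,
    fluxSign_testfun, fluxSign_density_lipschitz⟩

end Summit.AnomalousDissipation.AnomalousDissipation.Theorems
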